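import Summits.Ventures.PercRepro.MSMinLost
import Summits.Ventures.PercRepro.MSLemmaXWithin
import Summits.Ventures.PercRepro.MSTightCompletionRowsB

/-!
# (MIN) and (A∩′) within a sub-cube `2^M`

Dossier proofs/MINE1-theoremS.md, Addendum 57 suppl. 6–8 and Addendum 58; HANDOFF §mine-1
gen 32 → 33, step (K6a). `MSMinLostBridge.lean` states THEOREM (MIN) (`crossSet_eq_singleton`,
MSMinLost.lean — relative to an explicit ground set `G`) in Lemma X's vocabulary on the FULL cube.
The lane needs it inside the addable part `M` of a trace: `U₀ ⊆ U` up-sets WITHIN `M`, the lost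
sets `lostWithin M U U₀ T` of `MSTightCompletionRowsB.lean`, exact excess
`|U₀ ∖ T| = |Lost| + 1`. This file is the same bridge with `G = M`: `D = complWithin M U₀`
(a down-set of `2^M`), `A = lostUpWithin M U U₀ T` (the up-closure of the lost sets inside `M`),
`c = M ∖ y₁` for `y₁ ∈ U ∖ U₀` (`hypH_lostWithin`), `exc M D A = 1` (`exc_lostUpWithin_eq_one`),
hence for a MINIMAL lost `z`: **`filter_lost_eq_singleton_within`** — the members `y ∈ U₀` with
`z ⊆ y` and `y ∖ z ∉ U₀` are exactly `{y₁ ∪ z}` — and **`sdiff_mem_of_lost_within`** = (A∩′):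
`u ∈ U` containing `z` with `(M ∖ u) ∪ z ∈ U` and `M ∖ u ∉ U₀` has `u ∖ z ∈ U₀`.
-/

namespace PercRepro.MSTight

open Finset

variable {α : Type*} [DecidableEq α] {M : Finset α} {U U₀ T : Finset (Finset α)} {y₁ z : Finset α}

section Within

/-- The up-closure inside `M` of the lost sets. -/
def lostUpWithin (M : Finset α) (U U₀ T : Finset (Finset α)) : Finset (Finset α) :=
  M.powerset.filter fun a => ∃ z ∈ lostWithin M U U₀ T, z ⊆ a

/-- Membership in `lostUpWithin`. -/
theorem mem_lostUpWithin {a : Finset α} :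
    a ∈ lostUpWithin M U U₀ T ↔ a ⊆ M ∧ ∃ z ∈ lostWithin M U U₀ T, z ⊆ a := by
  simp only [lostUpWithin, mem_filter, mem_powerset]

/-- `cofG M` is `complWithin M`. -/
theorem cofG_eq_complWithin (A : Finset (Finset α)) : cofG M A = complWithin M A := rfl

/-- `M − U₀` is a down-set of the cube `2^M` when `U₀` is an up-set within `M`. -/
theorem isLowerIn_complWithin (hU₀M : ∀ y ∈ U₀, y ⊆ M) (hU₀ : IsUpSetWithin M U₀) :
    IsLowerIn M (complWithin M U₀) := by
  refine ⟨fun w hw => subset_of_mem_complWithin hw, ?_⟩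
  intro w w' hw'w hw
  rw [mem_coe] at hw ⊢
  have hwM := subset_of_mem_complWithin hw
  have hw'M : w' ⊆ M := hw'w.trans hwM
  rw [mem_complWithin_iff hU₀M hwM] at hw
  rw [mem_complWithin_iff hU₀M hw'M]
  exact hU₀ _ hw _ sdiff_subset (sdiff_subset_sdiff (Subset.refl _) hw'w)

/-- `lostUpWithin` is an up-set of the cube `2^M`. -/
theorem isUpperIn_lostUpWithin : IsUpperIn M (lostUpWithin M U U₀ T) := by
  refine ⟨fun a ha => (mem_lostUpWithin.1 ha).1, ?_⟩
  intro a ha b hab hbM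
  obtain ⟨-, z, hz, hza⟩ := mem_lostUpWithin.1 ha
  exact mem_lostUpWithin.2 ⟨hbM, z, hz, hza.trans hab⟩

/-- With `U ∖ U₀` nonempty, `∅` is not lost. -/
theorem empty_notMem_lostUpWithin (hy₁ : y₁ ∈ U \ U₀) : ∅ ∉ lostUpWithin M U U₀ T := by
  intro h
  obtain ⟨-, z, hz, hze⟩ := mem_lostUpWithin.1 h
  rw [subset_empty] at hze
  subst hze
  obtain ⟨hy₁U, hy₁U₀⟩ := mem_sdiff.1 hy₁
  exact hy₁U₀ (mem_sdiff.1 ((mem_lostWithin.1 hz).2 y₁ hy₁U (empty_subset _))).1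

/-- A minimal member of `lostUpWithin` is a lost set. -/
theorem mem_lostWithin_of_isMinIn (hz : IsMinIn (lostUpWithin M U U₀ T) z) :
    z ∈ lostWithin M U U₀ T := by
  obtain ⟨hzM, z', hz', hz'z⟩ := mem_lostUpWithin.1 hz.1
  have := hz.2 z' (mem_lostUpWithin.2 ⟨(hz'z.trans hzM), z', hz', Subset.refl z'⟩) hz'z
  rwa [← this]

/-- A lost set minimal among the lost sets is a minimal member of `lostUpWithin`. -/
theorem isMinIn_lostUpWithin_of_min (hz : z ∈ lostWithin M U U₀ T)
    (hmin : ∀ z' ∈ lostWithin M U U₀ T, z' ⊆ z → z' = z) : IsMinIn (lostUpWithin M U U₀ T) z := by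
  refine ⟨mem_lostUpWithin.2 ⟨subset_of_mem_complWithin (lostWithin_subset hz), z, hz,
    Subset.refl z⟩, fun y hy hyz => ?_⟩
  obtain ⟨-, z', hz', hz'y⟩ := mem_lostUpWithin.1 hy
  have := hmin z' hz' (hz'y.trans hyz)
  subst this
  exact Subset.antisymm hyz hz'y

/-- `(M ∖ a) ∖ b = M ∖ (a ∪ b)`. -/
theorem sdiff_sdiff_eq_sdiff_union_within (M a b : Finset α) : (M \ a) \ b = M \ (a ∪ b) := by
  ext x
  simp only [mem_sdiff, mem_union, not_or]
  tauto

/-- `(M ∖ a) ∪ b = M ∖ (a ∖ b)` for `b ⊆ M`. -/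
theorem sdiff_union_eq_sdiff_sdiff_within {M a b : Finset α} (hb : b ⊆ M) : (M \ a) ∪ b = M \ (a \ b) := by
  ext x
  simp only [mem_sdiff, mem_union, not_and, not_not]
  constructor
  · rintro (⟨hxM, hxa⟩ | hxb)
    · exact ⟨hxM, fun h => absurd h hxa⟩
    · exact ⟨hb hxb, fun _ => hxb⟩
  · rintro ⟨hxM, h⟩
    by_cases hxa : x ∈ a
    · exact Or.inr (h hxa)
    · exact Or.inl ⟨hxM, hxa⟩

/-- (H) holds for `c = M ∖ y₁`, `y₁ ∈ U ∖ U₀`. -/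
theorem hypH_lostWithin (hUM : ∀ y ∈ U, y ⊆ M) (hU : IsUpSetWithin M U) (hU₀ : IsUpSetWithin M U₀)
    (hU₀U : U₀ ⊆ U) (hy₁ : y₁ ∈ U \ U₀) :
    HypH (complWithin M U₀) (lostUpWithin M U U₀ T) (M \ y₁) := by
  have hU₀M : ∀ y ∈ U₀, y ⊆ M := fun y hy => hUM y (hU₀U hy)
  intro z hz
  have hzL := mem_lostWithin_of_isMinIn hz
  have hzM : z ⊆ M := subset_of_mem_complWithin (lostWithin_subset hzL)
  obtain ⟨hy₁U, hy₁U₀⟩ := mem_sdiff.1 hy₁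
  constructor
  · rw [sdiff_sdiff_eq_sdiff_union_within, mem_complWithin_iff hU₀M sdiff_subset,
      Finset.sdiff_sdiff_eq_self (union_subset (hUM y₁ hy₁U) hzM)]
    have h1 : y₁ ∪ z ∈ U := hU _ hy₁U _ (union_subset (hUM y₁ hy₁U) hzM) subset_union_left
    exact (mem_sdiff.1 ((mem_lostWithin.1 hzL).2 _ h1 subset_union_right)).1
  · rw [sdiff_union_eq_sdiff_sdiff_within hzM, mem_complWithin_iff hU₀M sdiff_subset,
      Finset.sdiff_sdiff_eq_self (sdiff_subset.trans (hUM y₁ hy₁U))]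
    intro h
    exact hy₁U₀ (hU₀ _ h _ (hUM y₁ hy₁U) sdiff_subset)

/-- `(M − U₀) ∩ lostUpWithin = Lost`. -/
theorem complWithin_inter_lostUpWithin :
    complWithin M U₀ ∩ lostUpWithin M U U₀ T = lostWithin M U U₀ T := by
  ext z
  rw [mem_inter, mem_lostUpWithin, mem_lostWithin]
  constructor
  · rintro ⟨hz, -, z', hz', hz'z⟩
    exact ⟨hz, fun g hg hzg => (mem_lostWithin.1 hz').2 g hg (hz'z.trans hzg)⟩
  · intro hz
    exact ⟨hz.1, subset_of_mem_complWithin hz.1, z, mem_lostWithin.2 hz, Subset.refl z⟩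

/-- `U₀ ∩ lostUpWithin ⊆ U₀ ∖ T`. -/
theorem inter_lostUpWithin_subset (hU₀U : U₀ ⊆ U) :
    U₀ ∩ lostUpWithin M U U₀ T ⊆ U₀ \ T := by
  intro g hg
  obtain ⟨hg₀, hgA⟩ := mem_inter.1 hg
  obtain ⟨-, z, hz, hzg⟩ := mem_lostUpWithin.1 hgA
  exact (mem_lostWithin.1 hz).2 g (hU₀U hg₀) hzg

/-- Complementation within `M` maps `U₀ ∩ lostUpWithin` onto `(M − U₀) ∩ (M − lostUpWithin)`. -/
theorem card_inter_lostUpWithin_eq (hU₀M : ∀ y ∈ U₀, y ⊆ M) :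
    (U₀ ∩ lostUpWithin M U U₀ T).card =
      (complWithin M U₀ ∩ complWithin M (lostUpWithin M U U₀ T)).card := by
  have hinj : Set.InjOn (fun y : Finset α => M \ y) ↑(U₀ ∩ lostUpWithin M U U₀ T) := by
    intro y hy y' hy' h
    simp only at h
    rw [← Finset.sdiff_sdiff_eq_self (hU₀M y (mem_inter.1 hy).1), h,
      Finset.sdiff_sdiff_eq_self (hU₀M y' (mem_inter.1 hy').1)]
  rw [← card_image_of_injOn hinj]
  congr 1
  ext w
  rw [mem_image, mem_inter, mem_complWithin, mem_complWithin]
  constructor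
  · rintro ⟨y, hy, rfl⟩
    exact ⟨⟨y, (mem_inter.1 hy).1, rfl⟩, ⟨y, (mem_inter.1 hy).2, rfl⟩⟩
  · rintro ⟨⟨y, hy, rfl⟩, ⟨a, ha, hay⟩⟩
    have : a = y := by
      rw [← Finset.sdiff_sdiff_eq_self ((mem_lostUpWithin.1 ha).1), hay,
        Finset.sdiff_sdiff_eq_self (hU₀M y hy)]
    rw [this] at ha
    exact ⟨y, mem_inter.2 ⟨hy, ha⟩, rfl⟩

/-- Exact excess `|U₀ ∖ T| = |Lost| + 1` gives excess one in the cube `2^M`. -/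
theorem exc_lostUpWithin_eq_one (hUM : ∀ y ∈ U, y ⊆ M) (hU : IsUpSetWithin M U)
    (hU₀ : IsUpSetWithin M U₀) (hU₀U : U₀ ⊆ U) (hy₁ : y₁ ∈ U \ U₀)
    (hexact : (U₀ \ T).card = (lostWithin M U U₀ T).card + 1) (hz : z ∈ lostWithin M U U₀ T)
    (hmin : ∀ z' ∈ lostWithin M U U₀ T, z' ⊆ z → z' = z) :
    exc M (complWithin M U₀) (lostUpWithin M U U₀ T) = 1 := by
  have hU₀M : ∀ y ∈ U₀, y ⊆ M := fun y hy => hUM y (hU₀U hy)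
  have hzmin := isMinIn_lostUpWithin_of_min hz hmin
  have hge := one_le_exc_of_crossSet_nonempty (isLowerIn_complWithin hU₀M hU₀)
    isUpperIn_lostUpWithin hzmin ⟨_, (hypH_lostWithin hUM hU hU₀ hU₀U hy₁).sdiff_mem_crossSet hzmin⟩
  have hle : exc M (complWithin M U₀) (lostUpWithin M U U₀ T) ≤ 1 := by
    unfold exc
    rw [cofG_eq_complWithin, ← card_inter_lostUpWithin_eq hU₀M, complWithin_inter_lostUpWithin]
    have := card_le_card (inter_lostUpWithin_subset (M := M) (T := T) hU₀U)
    omega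
  omega

/-- **(MIN) within `M`**: at exact excess, for a MINIMAL lost set `z` and any `y₁ ∈ U ∖ U₀`, the
members of `U₀` containing `z` whose `z`-free part leaves `U₀` are exactly `{y₁ ∪ z}`. -/
theorem filter_lost_eq_singleton_within (hUM : ∀ y ∈ U, y ⊆ M) (hU : IsUpSetWithin M U)
    (hU₀ : IsUpSetWithin M U₀) (hU₀U : U₀ ⊆ U) (hy₁ : y₁ ∈ U \ U₀)
    (hexact : (U₀ \ T).card = (lostWithin M U U₀ T).card + 1) (hz : z ∈ lostWithin M U U₀ T)
    (hmin : ∀ z' ∈ lostWithin M U U₀ T, z' ⊆ z → z' = z) :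
    U₀.filter (fun y => z ⊆ y ∧ y \ z ∉ U₀) = {y₁ ∪ z} := by
  have hU₀M : ∀ y ∈ U₀, y ⊆ M := fun y hy => hUM y (hU₀U hy)
  have hzM : z ⊆ M := subset_of_mem_complWithin (lostWithin_subset hz)
  have hzmin := isMinIn_lostUpWithin_of_min hz hmin
  have key := crossSet_eq_singleton (isLowerIn_complWithin hU₀M hU₀) isUpperIn_lostUpWithin
    (empty_notMem_lostUpWithin hy₁) sdiff_subset (hypH_lostWithin hUM hU hU₀ hU₀U hy₁)
    (exc_lostUpWithin_eq_one hUM hU hU₀ hU₀U hy₁ hexact hz hmin) hzmin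
  ext y
  rw [mem_filter, mem_singleton]
  constructor
  · rintro ⟨hy, hzy, hyz⟩
    have hyM := hU₀M y hy
    have hcross : M \ y ∈ crossSet (complWithin M U₀) z := by
      refine mem_crossSet.2 ⟨mem_complWithin.2 ⟨y, hy, rfl⟩, ?_, ?_⟩
      · rw [disjoint_left]
        intro x hx hxz
        exact (mem_sdiff.1 hx).2 (hzy hxz)
      · rw [sdiff_union_eq_sdiff_sdiff_within hzM, mem_complWithin_iff hU₀M sdiff_subset,
          Finset.sdiff_sdiff_eq_self (sdiff_subset.trans hyM)]
        exact hyz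
    rw [key, mem_singleton, sdiff_sdiff_eq_sdiff_union_within] at hcross
    rw [← Finset.sdiff_sdiff_eq_self hyM, hcross,
      Finset.sdiff_sdiff_eq_self (union_subset (hUM y₁ (mem_sdiff.1 hy₁).1) hzM)]
  · rintro rfl
    have hcross : (M \ y₁) \ z ∈ crossSet (complWithin M U₀) z := by
      rw [key]
      exact mem_singleton_self _
    obtain ⟨hv, hdisj, hvz⟩ := mem_crossSet.1 hcross
    rw [sdiff_sdiff_eq_sdiff_union_within, mem_complWithin_iff hU₀M sdiff_subset,
      Finset.sdiff_sdiff_eq_self (union_subset (hUM y₁ (mem_sdiff.1 hy₁).1) hzM)] at hv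
    refine ⟨hv, subset_union_right, fun h => hvz ?_⟩
    rw [sdiff_sdiff_eq_sdiff_union_within, sdiff_union_eq_sdiff_sdiff_within hzM,
      mem_complWithin_iff hU₀M sdiff_subset,
      Finset.sdiff_sdiff_eq_self (sdiff_subset.trans (union_subset (hUM y₁ (mem_sdiff.1 hy₁).1) hzM))]
    exact h

/-- **(A∩′) within `M`** (Addendum 57 suppl. 6–8): at exact excess, let `u ∈ U` contain a minimal
lost set `z`, and let `(M ∖ u) ∪ z ∈ U` while `M ∖ u ∉ U₀`. Then `u ∖ z ∈ U₀`. -/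
theorem sdiff_mem_of_lost_within (hUM : ∀ y ∈ U, y ⊆ M) (hU : IsUpSetWithin M U)
    (hU₀ : IsUpSetWithin M U₀) (hU₀U : U₀ ⊆ U) (hU₁ : (U \ U₀).Nonempty)
    (hexact : (U₀ \ T).card = (lostWithin M U U₀ T).card + 1) (hz : z ∈ lostWithin M U U₀ T)
    (hmin : ∀ z' ∈ lostWithin M U U₀ T, z' ⊆ z → z' = z) {u : Finset α} (hu : u ∈ U) (hzu : z ⊆ u)
    (hg : (M \ u) ∪ z ∈ U) (hnot : M \ u ∉ U₀) : u \ z ∈ U₀ := by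
  obtain ⟨y₁, hy₁⟩ := hU₁
  have key := filter_lost_eq_singleton_within hUM hU hU₀ hU₀U hy₁ hexact hz hmin
  have hzL := mem_lostWithin.1 hz
  have huM := hUM u hu
  have hg₂ : (M \ u) ∪ z ∈ U₀.filter (fun y => z ⊆ y ∧ y \ z ∉ U₀) := by
    rw [mem_filter]
    refine ⟨(mem_sdiff.1 (hzL.2 _ hg subset_union_right)).1, subset_union_right, ?_⟩
    have : ((M \ u) ∪ z) \ z = M \ u := by
      rw [union_sdiff_right]
      exact sdiff_eq_left.2 (disjoint_sdiff_self_left.mono_right hzu)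
    rw [this]
    exact hnot
  rw [key, mem_singleton] at hg₂
  by_contra h
  have huU₀ : u ∈ U₀ := (mem_sdiff.1 (hzL.2 u hu hzu)).1
  have hmem : u ∈ U₀.filter (fun y => z ⊆ y ∧ y \ z ∉ U₀) := mem_filter.2 ⟨huU₀, hzu, h⟩
  rw [key, mem_singleton] at hmem
  -- `u = y₁ ∪ z = (M ∖ u) ∪ z` forces `u = M`
  have huniv : u = M := by
    refine Subset.antisymm huM fun x hxM => ?_
    by_cases hxu : x ∈ u
    · exact hxu
    · have : x ∈ (M \ u) ∪ z := mem_union_left _ (mem_sdiff.2 ⟨hxM, hxu⟩)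
      rw [hg₂, ← hmem] at this
      exact absurd this hxu
  apply h
  have hzM : z ⊆ M := subset_of_mem_complWithin (lostWithin_subset hz)
  rw [huniv, ← mem_complWithin_iff (fun y hy => hUM y (hU₀U hy)) hzM]
  exact lostWithin_subset hz

end Within

end PercRepro.MSTight
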